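import Mathlib
import Summits.RiemannHypothesis.RiemannHypothesis.Theorems.SoloBlindFlatLobeN3

/-!
# SoloBlind — flat tops in degree 3 are symmetric; the family-(b) bound (K⁺, n = 3, completion)

Solo/blind artefact (unit `solo-RiemannHypothesis-blind`, claim C81), companion to `SoloBlindFlatLobeN3`.
EXTREMAL-PROBLEM statements about non-negative trigonometric polynomials; no bearing on `RiemannHypothesis`.

(1) SYMMETRY OF FLAT TOPS.  Let `T = |g|²`, `g(z) = (z − e^{iζ₁})(z − e^{iζ₂})(z − β)`, `β = C + iS` off the circle,
and suppose `θ = 0` is a flat point: `T(0) > 0`, `T′(0) = T″(0) = T‴(0) = 0`.  With `F = log T = Σ_roots log|e^{iθ} − w|²`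
the conditions are ADDITIVE in the roots: for a unimodular root, with `p = cot(ζ/2)`, the first three
`θ`-derivatives of `log|e^{iθ} − e^{iζ}|²` at `0` are `−p, −(1+p²)/2, −(1+p²)p/2`; for `β`, with
`D₀ = |1 − β|² = 1 + C² + S² − 2C`, they are `−2S/D₀`, `(2C D₀ − 4S²)/D₀²`, `2S(D₀² + 6C D₀ − 8S²)/D₀³`
(hand computation, checked numerically in the notes).  Hence, with `σ = 2S/D₀`,
`ρ₂ = 2(2C D₀ − 4S²)/D₀² − 2`, `Q = D₀² + 6C D₀ − 8S²`:
`p₁ + p₂ = −σ`, `p₁² + p₂² = ρ₂`, and — IF `S ≠ 0` — `p₁² − p₁p₂ + p₂² + 1 = −2Q/D₀²`, i.e. the consistency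
equation `G := (3ρ₂ − σ²)/2 + 1 + 2Q/D₀² = 0`, while reality of `p₁, p₂` needs `R := 2ρ₂ − σ² ≥ 0`.
THIS FILE CERTIFIES the two closed forms `D₀²·G = 6(3C D₀ − 5S²)`, `D₀²·R = 4(2C D₀ − 5S² − D₀²)` and the
implication `D₀ > 0 ∧ R ≥ 0 ⟹ G > 0`.  So `S ≠ 0` is impossible: `β` is real, and then `p₁ + p₂ = 0`, i.e.
`ζ₂ ≡ −ζ₁`: every flat-top configuration of the two-zero family is SYMMETRIC (the reduction that was only
Newton-search evidence in the notes).

(2) FAMILY (b) BOUND.  By an affine-pencil argument (notes, 5.4): over `{T ∈ 𝒯₃⁺ : T(0) = 0, x flat}` the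
ratio `T(x)/mean` is maximised by a polynomial with a second double zero, hence — by (1) — by a member of the
symmetric flat family of `SoloBlindFlatLobeN3`, where `b²·T(0) = 4(1−b)⁶` and `b²·mean = D(b)`.  Certified
here: on the flat-top relation `c·b = b − (1−b)²`, `b > 0`:  `T(0) < 3·mean`, via
`b²(3·mean − T(0)) = 8(b−1)⁶ − 54b²(b−1)² + 60b³ = 8((b−1)² − 3b/2)²((b−1)² + 3b) + 6b³ > 0`.
Consequently the structure-(b) value `Ψ = 2·T(x)` is `< 6·mean` (numerically `≤ 2·50/23 = 4.348`).
-/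

namespace Summit.RiemannHypothesis.RiemannHypothesis.Theorems

noncomputable section

/-! ### (1) the symmetric-reduction algebra -/

/-- `σ = 2S/D₀` (sum condition `p₁ + p₂ = −σ`). -/
def soloBlindFlatSigma (S D : ℝ) : ℝ := 2*S/D
/-- `ρ₂ = 2(2C D₀ − 4S²)/D₀² − 2` (the value of `p₁² + p₂²`). -/
def soloBlindFlatRho (C S D : ℝ) : ℝ := 2*(2*C*D - 4*S^2)/D^2 - 2
/-- `Q = D₀² + 6C D₀ − 8S²` (numerator of the third `β`-derivative). -/
def soloBlindFlatQ (C S D : ℝ) : ℝ := D^2 + 6*C*D - 8*S^2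
/-- Consistency function `G = (3ρ₂ − σ²)/2 + 1 + 2Q/D₀²` (must vanish if `S ≠ 0`). -/
def soloBlindFlatG (C S D : ℝ) : ℝ :=
  (3 * soloBlindFlatRho C S D - (soloBlindFlatSigma S D)^2)/2 + 1 + 2 * soloBlindFlatQ C S D / D^2
/-- Reality discriminant `R = 2ρ₂ − σ² = (p₁ − p₂)²`. -/
def soloBlindFlatR (C S D : ℝ) : ℝ := 2 * soloBlindFlatRho C S D - (soloBlindFlatSigma S D)^2

/-- Closed form of the cubic flatness obstruction: `D² · G = 6 (3 C D − 5 S²)`. -/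
theorem soloBlind_flatG_closed (C S D : ℝ) (hD : D ≠ 0) :
    D^2 * soloBlindFlatG C S D = 6*(3*C*D - 5*S^2) := by
  unfold soloBlindFlatG soloBlindFlatRho soloBlindFlatSigma soloBlindFlatQ
  field_simp
  ring

/-- Closed form of the reality discriminant `(p₁ − p₂)² = 2ρ₂ − σ²`: `D² · R = 4 (2 C D − 5 S² − D²)`. -/
theorem soloBlind_flatR_closed (C S D : ℝ) (hD : D ≠ 0) :
    D^2 * soloBlindFlatR C S D = 4*(2*C*D - 5*S^2 - D^2) := by
  unfold soloBlindFlatR soloBlindFlatRho soloBlindFlatSigma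
  field_simp
  ring

/-- The contradiction for `S ≠ 0`: reality of the two zero angles forces `G > 0`, so `G = 0` cannot hold. -/
theorem soloBlind_flat_symmetric_core (C S D : ℝ) (hD : 0 < D) (hR : 0 ≤ soloBlindFlatR C S D) :
    0 < soloBlindFlatG C S D := by
  have hD0 : D ≠ 0 := ne_of_gt hD
  have h1 := soloBlind_flatG_closed C S D hD0
  have h2 := soloBlind_flatR_closed C S D hD0
  have hD2 : 0 < D^2 := by positivity
  have hRD : 0 ≤ D^2 * soloBlindFlatR C S D := mul_nonneg hD2.le hR
  -- from `R ≥ 0`: `2CD − 5S² ≥ D² > 0`, hence `C D > 0` and `3CD − 5S² > 0`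
  have h3 : 0 ≤ 2*C*D - 5*S^2 - D^2 := by nlinarith [h2, hRD]
  have h4 : 0 < C*D := by nlinarith [h3, hD2, sq_nonneg S]
  have h5 : 0 < 6*(3*C*D - 5*S^2) := by nlinarith [h3, h4, hD2]
  have h6 : 0 < D^2 * soloBlindFlatG C S D := by rw [h1]; exact h5
  exact pos_of_mul_pos_right h6 hD2.le

/-- With `β` real (`S = 0`) the first condition reads `p₁ + p₂ = 0`; recorded: `σ = 0`. -/
theorem soloBlind_flatSigma_real (D : ℝ) : soloBlindFlatSigma 0 D = 0 := by
  unfold soloBlindFlatSigma; simp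

/-! ### (2) the family-(b) bound on the symmetric flat family -/

/-- On the flat-top relation, `b²·T(0) = 4(1−b)⁶`. -/
theorem soloBlind_flat_top_closed (b c : ℝ) (h : c*b = b - (1 - b)^2) :
    b^2 * soloBlindFlatTop b c = 4*(1 - b)^6 := by
  unfold soloBlindFlatTop
  have h1 : b*(1 - c) = (1 - b)^2 := by linear_combination (-1 : ℝ) * h
  calc b^2 * (4*(1 - c)^2*(1 - b)^2) = 4*(b*(1 - c))^2*(1 - b)^2 := by ring
    _ = 4*((1 - b)^2)^2*(1 - b)^2 := by rw [h1]
    _ = 4*(1 - b)^6 := by ring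

/-- The identity `b²(3·mean − T(0)) = 8(b−1)⁶ − 54b²(b−1)² + 60b³` on the flat-top relation. -/
theorem soloBlind_flat_b_identity (b c : ℝ) (h : c*b = b - (1 - b)^2) :
    b^2 * (3 * soloBlindFlatMean b c - soloBlindFlatTop b c)
      = 8*(b - 1)^6 - 54*b^2*(b - 1)^2 + 60*b^3 := by
  unfold soloBlindFlatMean soloBlindFlatTop
  linear_combination ((8*b + 8*b^2 + 8*b^3)*c + (-8 + 24*b + 16*b^2 + 24*b^3 - 8*b^4)) * h

/-- Positivity: `8(b−1)⁶ − 54b²(b−1)² + 60b³ = 8((b−1)² − 3b/2)²((b−1)² + 3b) + 6b³ > 0` for `b > 0`. -/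
theorem soloBlind_flat_b_pos (b : ℝ) (hb : 0 < b) :
    0 < 8*(b - 1)^6 - 54*b^2*(b - 1)^2 + 60*b^3 := by
  have key : 8*(b - 1)^6 - 54*b^2*(b - 1)^2 + 60*b^3
      = 8*((b - 1)^2 - 3/2*b)^2*((b - 1)^2 + 3*b) + 6*b^3 := by ring
  have q0 : 0 < (b - 1)^2 + 3*b := by nlinarith [sq_nonneg (b - 1)]
  have q1 : 0 ≤ 8*((b - 1)^2 - 3/2*b)^2*((b - 1)^2 + 3*b) := by positivity
  have q2 : 0 < 6*b^3 := by positivity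
  linarith [key, q1, q2]

/-- FAMILY (b): the flat top is `< 3·mean`, so its double count `2·T(0)` is `< 6·mean`. -/
theorem soloBlind_flat_top_lt_three_mean (b c : ℝ) (hb : 0 < b) (h : c*b = b - (1 - b)^2) :
    soloBlindFlatTop b c < 3 * soloBlindFlatMean b c := by
  have hid := soloBlind_flat_b_identity b c h
  have hP := soloBlind_flat_b_pos b hb
  have hprod : 0 < b^2 * (3 * soloBlindFlatMean b c - soloBlindFlatTop b c) := by rw [hid]; exact hP
  have hb2 : 0 ≤ b^2 := by positivity
  have := pos_of_mul_pos_right hprod hb2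
  linarith

/-- Family (b) of the `n = 3` enumeration: the doubly counted flat lobe satisfies `2·top < 6·mean`. -/
theorem soloBlind_family_b_bound (b c : ℝ) (hb : 0 < b) (h : c*b = b - (1 - b)^2) :
    2 * soloBlindFlatTop b c < 6 * soloBlindFlatMean b c := by
  linarith [soloBlind_flat_top_lt_three_mean b c hb h]

/-- The sharp constant: `T(0)/mean ≤ 50/23` on the family, with equality iff `3b² − 11b + 3 = 0`
(`b = (11 ± √85)/6`), via `b²(50·mean − 23·T(0)) = 50·D(b) − 92(1−b)⁶ = 4(3b² − 11b + 3)²(3b² + 4b + 3)`. -/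
theorem soloBlind_flat_top_sharp (b c : ℝ) (hb : 0 < b) (h : c*b = b - (1 - b)^2) :
    23 * soloBlindFlatTop b c ≤ 50 * soloBlindFlatMean b c := by
  have ht := soloBlind_flat_top_closed b c h
  have hm := soloBlind_flat_mean_closed b c h
  have hb2 : 0 < b^2 := by positivity
  have key : b^2 * (50 * soloBlindFlatMean b c - 23 * soloBlindFlatTop b c)
      = 4*(3*b^2 - 11*b + 3)^2*(3*b^2 + 4*b + 3) := by
    linear_combination (50 : ℝ) * hm - (23 : ℝ) * ht
  have q0 : 0 < 3*b^2 + 4*b + 3 := by nlinarith [sq_nonneg b]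
  have pos : 0 ≤ 4*(3*b^2 - 11*b + 3)^2*(3*b^2 + 4*b + 3) :=
    mul_nonneg (by positivity) q0.le
  have : 0 ≤ b^2 * (50 * soloBlindFlatMean b c - 23 * soloBlindFlatTop b c) := by rw [key]; exact pos
  nlinarith [this, hb2]

/-- … and the constant is attained: at a root of `3b² − 11b + 3` equality holds. -/
theorem soloBlind_flat_top_sharp_eq (b c : ℝ) (hb : 0 < b) (h : c*b = b - (1 - b)^2)
    (hroot : 3*b^2 - 11*b + 3 = 0) :
    23 * soloBlindFlatTop b c = 50 * soloBlindFlatMean b c := by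
  have ht := soloBlind_flat_top_closed b c h
  have hm := soloBlind_flat_mean_closed b c h
  have hb2 : b^2 ≠ 0 := by positivity
  have key : b^2 * (50 * soloBlindFlatMean b c - 23 * soloBlindFlatTop b c)
      = 4*(3*b^2 - 11*b + 3)^2*(3*b^2 + 4*b + 3) := by
    linear_combination (50 : ℝ) * hm - (23 : ℝ) * ht
  rw [hroot] at key
  have : 50 * soloBlindFlatMean b c - 23 * soloBlindFlatTop b c = 0 := by
    have hz : b^2 * (50 * soloBlindFlatMean b c - 23 * soloBlindFlatTop b c) = 0 := by rw [key]; ring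
    rcases mul_eq_zero.mp hz with h0 | h0
    · exact absurd h0 hb2
    · exact h0
  linarith

end

end Summit.RiemannHypothesis.RiemannHypothesis.Theorems
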